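import Summits.Langlands.Langlands.Theses.OrdinaryPrimeTransport
import HarnessLib

/-!
# Crux `RankinSelbergPoleCountR` (stmt-Langlands-17870) — the strategist's typed split
(glue for `ledger route edit --split RankinSelbergPoleCountR`)

Route `route-Langlands-OrdinaryPrimeTransport`, crux `hRS` of `closes` (rank 4; the rank-guarded repair
of the refuted-misstated `RankinSelbergPoleCount`, stmt-Langlands-17212).  THE CRUX: for `n ≥ 2`, any
number field `K`, `π` cuspidal on `GL_n(𝔸_K)`, a compatible avatar `ρ₀ : Γ_K → GL_n(ℚ̄_ℓ₀)` at `ι₀`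
that is NOT irreducible, and STRONG potential automorphy of EVERY irreducible exact framed summand
`σ` of `ρ₀`, each summand WITH ITS OWN Galois CM field `F'_σ` — `False`.

STRATEGIST'S CENSUS (`Cruxes/RankinSelbergPoleCountR/STRATEGY-CENSUS.md`): every printed pole count
(Barnet-Lamb–Gee–Geraghty–Taylor, Prop. 5.4.6 / Thm. 5.5.2; Patrikis–Taylor, Thm. 1.7) runs ONE Brauer
induction over ONE Galois `F'/K` over which ALL constituents are automorphic, because the cross terms
`L(s, σ_i ⊗ σ̄_j)`, `i ≠ j`, must be Rankin–Selberg `L`-functions of two automorphic representations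
over the SAME field.  With per-summand fields this is unavailable: if `F'_1`, `F'_2` are linearly
disjoint over `K`, a field reachable from both by the only tools in print (restriction to a
solvable-co-Galois subfield, Arthur–Clozel solvable base change) exists only when `Gal(F'_2/K)` is
solvable (census, §Transfer) — the catalogued `Literature.Barriers.Langlands.SolvableImageBarrier`.
The diagonal terms alone (Landau's lemma + Cauchy–Schwarz on `log L^S(s, π × π̄) = Σ |Σ_i tr σ_i|²`)
settle only the sub-case in which ONE constituent attains the extremal slope (census, §Decomposition);
the tied case — the generic one, forced by purity whenever purity holds — needs the cross terms.

Hence the honest map of this crux is the three-piece split below, whose conjunction implies the crux by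
pure logic (this file) and whose pieces are typed verbatim as the `statement`s filed with
`route edit --split` (arrow form: the hypotheses of `rankinSelbergPoleCountR_of_subs` ARE the children):

* CHILD 1 `ConstituentSplitting` (support; M, provable now — Jordan–Hölder + block-triangular framing):
  a non-irreducible framed `ρ₀` of rank `n ≥ 2` has `m ≥ 2` irreducible framed constituents `σ_i` of
  ranks `0 < k_i < n` with `charpoly ρ₀ = ∏ charpoly σ_i` on `Γ_K` and, for each `i`, an exact framed
  complement `τ_i` of rank `n - k_i`.  [cite: CurtisReiner1962, §82 (30.16) and §10]
* CHILD 2 `SummandFieldAmalgamation` (crux; THE OPEN KERNEL, ≈ non-solvable base change; the route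
  repair that restates `SummandsPotentiallyAutomorphic` jointly over the constituent family makes it
  moot): per-summand strong potential automorphy of a finite family ⇒ JOINT strong potential automorphy
  over ONE Galois `F'/K`.  [cite: BarnetlambEtAl2014, Thm. 4.5.1] [cite: Taylor2006, Thm. A]
* CHILD 3 `JointRankinSelbergPoleCount` (crux; L/XL, THE HEART — the purity-free pole count proper,
  attackable now with the tree's `partialPairL` / Jacquet–Shalika / Landau toolkit): `π` cuspidal,
  `ρ₀` compatible, a constituent family (`m ≥ 2`, `0 < k_i`, `charpoly ρ₀ = ∏ charpoly σ_i`) that is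
  JOINTLY strongly potentially automorphic ⇒ `False`.  [cite: PatrikisTaylor2014, Thm. 1.7]
  [cite: BarnetlambEtAl2014, Prop. 5.4.6 and Thm. 5.5.2] [cite: JacquetShalikaAJM1981, Thm. 5.3]
  [cite: ShahidiAJM1981, Thm. 5.2]

THEOREM: `rankinSelbergPoleCountR_of_subs : CHILD 1 → CHILD 2 → CHILD 3 → RankinSelbergPoleCountR`
(pure logic: split `ρ₀`, feed each `(σ_i, τ_i)` to the crux's per-summand hypothesis, amalgamate, count).
It is the composition `RankinSelbergPoleCountR_of` of the registered birth skeleton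
(`Cruxes/RankinSelbergPoleCountR/Lines/birth.lean`, stubs `stub_constituents` / `stub_amalgamation` /
`stub_jointPoleCount`) with the stubs promoted to hypotheses and their notions inlined, so that the
children are route items provers, grounders and the route-repair planner can see.  No `sorry`, no new
definitions, no Literature imports beyond the route file.  Honours the negatives index: the guard
`2 ≤ n` of the crux is kept in CHILD 3 and `2 ≤ m`, `0 < k_i` exclude the rank-`0` witness of
`OrdinaryPrimeTransportRankinSelbergPoleCount_refuted`.
-/

-- `Summit.<Summit>.<Problem>`: for the single-conjunct summit `Langlands` the duplicate is deliberate.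
set_option linter.dupNamespace false

noncomputable section

namespace Summit.Langlands.Langlands.Theorems

open Summit.Langlands.Langlands.Theses.OrdinaryPrimeTransport
open scoped BigOperators
open Filter

/-- **The crux `RankinSelbergPoleCountR` from its three typed children** (constituent splitting,
summand-field amalgamation, joint purity-free Rankin–Selberg pole count), by pure logic: given
`n ≥ 2`, `π`, a compatible non-irreducible `ρ₀` and the crux's per-summand potential-automorphy
hypothesis, split `ρ₀` into irreducible constituents `σ_i` with exact complements `τ_i` (child 1);
each `(σ_i, τ_i)` is an irreducible exact summand of rank `0 < k_i < n`, so the hypothesis makes every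
`σ_i` strongly potentially automorphic with its own field; amalgamate the fields (child 2); the joint
pole count (child 3) is the contradiction.  The three hypotheses are, verbatim, the statements filed as
the children of the split. [folklore] -/
theorem rankinSelbergPoleCountR_of_subs :
    -- CHILD 1: ConstituentSplitting
    (∀ (K : Type) [Field K] [NumberField K] (ℓ₀ : ℕ) [Fact ℓ₀.Prime] (n : ℕ), 2 ≤ n → ∀ (ρ₀ : Literature.NumberTheory.GaloisRepresentations.FramedGaloisRep K (PadicAlgCl ℓ₀) n), ¬ ρ₀.toGaloisRep.IsIrreducible → ∃ (m : ℕ) (k : Fin m → ℕ) (σ : (i : Fin m) → Literature.NumberTheory.GaloisRepresentations.FramedGaloisRep K (PadicAlgCl ℓ₀) (k i)), 2 ≤ m ∧ (∀ i, 0 < k i ∧ k i < n) ∧ (∀ i, (σ i).toGaloisRep.IsIrreducible) ∧ (∀ g : Field.absoluteGaloisGroup K, ρ₀.charpoly g = ∏ i, (σ i).charpoly g) ∧ ∀ i, ∃ τ : Literature.NumberTheory.GaloisRepresentations.FramedGaloisRep K (PadicAlgCl ℓ₀) (n - k i), ∀ g : Field.absoluteGaloisGroup K, ρ₀.charpoly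 g = (σ i).charpoly g * τ.charpoly g) →
    -- CHILD 2: SummandFieldAmalgamation
    (∀ (K : Type) [Field K] [NumberField K] (ℓ₀ : ℕ) [Fact ℓ₀.Prime] (ι₀ : PadicAlgCl ℓ₀ ≃+* ℂ) (m : ℕ) (k : Fin m → ℕ) (σ : (i : Fin m) → Literature.NumberTheory.GaloisRepresentations.FramedGaloisRep K (PadicAlgCl ℓ₀) (k i)), (∀ i : Fin m, ∃ (F' : Type) (_ : Field F') (_ : NumberField F') (_ : Algebra K F') (_ : IsGalois K F'), NumberField.IsCMField F' ∧ ((σ i).restrictField F').toGaloisRep.IsIrreducible ∧ ∀ (E : Type) [Field E] [NumberField E] [Algebra K E] [Algebra E F'] [IsScalarTower K E F'], IsSolvable (F' ≃ₐ[E] F') → ∃ (hE : Literature.NumberTheory.Automorphic.isCompact_glFiniteIntegralLevel (k i) E) (P : Literature.NumberTheory.Automorphic.CuspidalAutomorphicRepData (k i) E hE), ∀ᶠ w : IsDedekindDomain.HeightOneSpectrum (NumberField.RingOfIntegers E) in Filter.cofinite, Summit.Langlands.SatakeFrobCompatibleAt ι₀ P.1 ((σ i).restrictField E) w) → ∃ (F'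 : Type) (_ : Field F') (_ : NumberField F') (_ : Algebra K F') (_ : IsGalois K F'), ∀ i : Fin m, ((σ i).restrictField F').toGaloisRep.IsIrreducible ∧ ∀ (E : Type) [Field E] [NumberField E] [Algebra K E] [Algebra E F'] [IsScalarTower K E F'], IsSolvable (F' ≃ₐ[E] F') → ∃ (hE : Literature.NumberTheory.Automorphic.isCompact_glFiniteIntegralLevel (k i) E) (P : Literature.NumberTheory.Automorphic.CuspidalAutomorphicRepData (k i) E hE), ∀ᶠ w : IsDedekindDomain.HeightOneSpectrum (NumberField.RingOfIntegers E) in Filter.cofinite, Summit.Langlands.SatakeFrobCompatibleAt ι₀ P.1 ((σ i).restrictField E) w) →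
    -- CHILD 3: JointRankinSelbergPoleCount
    (∀ (n : ℕ), 2 ≤ n → ∀ (K : Type) [Field K] [NumberField K] (hcpt : Literature.NumberTheory.Automorphic.isCompact_glFiniteIntegralLevel n K) (π : Literature.NumberTheory.Automorphic.CuspidalAutomorphicRepData n K hcpt) (ℓ₀ : ℕ) [Fact ℓ₀.Prime] (ι₀ : PadicAlgCl ℓ₀ ≃+* ℂ) (ρ₀ : Literature.NumberTheory.GaloisRepresentations.FramedGaloisRep K (PadicAlgCl ℓ₀) n), (∀ᶠ v : IsDedekindDomain.HeightOneSpectrum (NumberField.RingOfIntegers K) in Filter.cofinite, Summit.Langlands.SatakeFrobCompatibleAt ι₀ π.1 ρ₀ v) → ∀ (m : ℕ), 2 ≤ m → ∀ (k : Fin m → ℕ), (∀ i, 0 < k i) → ∀ (σ : (i : Fin m) → Literature.NumberTheory.GaloisRepresentations.FramedGaloisRep K (PadicAlgCl ℓ₀) (k i)), (∀ g : Field.absoluteGaloisGroup K, ρ₀.charpoly g = ∏ i, (σ i).charpoly g) → (∃ (F' : Type) (_ : Field F') (_ : NumberField F') (_ : Algebra K F') (_ : IsGalois K F'), ∀ i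 : Fin m, ((σ i).restrictField F').toGaloisRep.IsIrreducible ∧ ∀ (E : Type) [Field E] [NumberField E] [Algebra K E] [Algebra E F'] [IsScalarTower K E F'], IsSolvable (F' ≃ₐ[E] F') → ∃ (hE : Literature.NumberTheory.Automorphic.isCompact_glFiniteIntegralLevel (k i) E) (P : Literature.NumberTheory.Automorphic.CuspidalAutomorphicRepData (k i) E hE), ∀ᶠ w : IsDedekindDomain.HeightOneSpectrum (NumberField.RingOfIntegers E) in Filter.cofinite, Summit.Langlands.SatakeFrobCompatibleAt ι₀ P.1 ((σ i).restrictField E) w) → False) →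
    RankinSelbergPoleCountR := by
  intro h₁ h₂ h₃
  intro n hn K _ _ hcpt π ℓ₀ _ ι₀ ρ₀ hρ₀ hirr hsum
  obtain ⟨m, k, σ, hm, hk, hσirr, hchar, hτ⟩ := h₁ K ℓ₀ n hn ρ₀ hirr
  -- every constituent is an irreducible exact summand, hence strongly potentially automorphic
  -- (each with ITS OWN Galois CM field)
  have hPA : ∀ i : Fin m, ∃ (F' : Type) (_ : Field F') (_ : NumberField F') (_ : Algebra K F')
      (_ : IsGalois K F'), NumberField.IsCMField F' ∧
        ((σ i).restrictField F').toGaloisRep.IsIrreducible ∧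
        ∀ (E : Type) [Field E] [NumberField E] [Algebra K E] [Algebra E F'] [IsScalarTower K E F'],
          IsSolvable (F' ≃ₐ[E] F') →
            ∃ (hE : Literature.NumberTheory.Automorphic.isCompact_glFiniteIntegralLevel (k i) E)
              (P : Literature.NumberTheory.Automorphic.CuspidalAutomorphicRepData (k i) E hE),
              ∀ᶠ w : IsDedekindDomain.HeightOneSpectrum (NumberField.RingOfIntegers E) in
                Filter.cofinite,
                Summit.Langlands.SatakeFrobCompatibleAt ι₀ P.1 ((σ i).restrictField E) w := by
    intro i
    obtain ⟨τ, hτi⟩ := hτ i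
    exact hsum (k i) (hk i).1 (hk i).2 (σ i) τ (hσirr i) hτi
  -- amalgamate the fields (child 2) and count poles over the common field (child 3)
  exact h₃ n hn K hcpt π ℓ₀ ι₀ ρ₀ hρ₀ m hm k (fun i => (hk i).1) σ hchar (h₂ K ℓ₀ ι₀ m k σ hPA)

end Summit.Langlands.Langlands.Theorems

end
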